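import Literature.MathematicalPhysics.QuantumFieldTheory.Balaban1983to89.B12Eq441DeltaJStructure
import Literature.MathematicalPhysics.QuantumFieldTheory.Balaban1983to89.B12Moments443
import Literature.MathematicalPhysics.QuantumFieldTheory.Balaban1983to89.B12WholeLattice290

/-!
# B12 pp. 291–292, the paragraph (4.42)–(4.45) FOR BAŁABAN'S `Δ_j` ITSELF, in the lineage's (4.34)-table
# currency: (4.42) with EXPLICIT irrelevant terms, (4.43) ⇒ (4.44), (4.45) ⇒ «hence this term vanishes», and the
# p. 292 sentence «The corresponding terms from (4.34) are equal to (4.42), (4.44) also, hence both groups of terms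
# cancel» as block-by-block identities against any `Π` with «an expansion of the form (4.41) with a coefficient β»

statement-level skeleton of published theorems with citation tags; proofs where landed; nothing here is a
claim about the Yang–Mills mass gap.

Source: T. Bałaban, *Renormalization group approach to lattice gauge field theories. I*, Commun. Math. Phys.
**109** (1987) 249–301 (`Balaban1987RG1`, "B12"), pp. 290–292 [PDF 42–44] and pp. 297–298 [PDF 49–50] (held:
`lit read paper:balaban1987-cmp109-rg-i-small-field --pages 42-44`; journal page = PDF page + 248).
PDF held: yes.  Unit `lit-balaban` (HOME `run/shared/lean/pub/lit-balaban/`), Phase-2 proof seat p10 (gen 8, file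
2/2; file 1/2 = `B12Eq441DeltaJStructure`); WHAT IS REPRODUCED = SKELETON row `B12.Eq4.42-4.45` — members (4.42),
(4.44), (4.45)-consequence, written for (4.40) `β_j(g_{j−1})Δ_j` with the TYPED `Δ_j` (`B12Eq441SymbolExpansion.
symbDeltaJ` = [B5] (1.66), kernel `B12Eq443LatticeMoments.kerDeltaJ` on `ℤ^{d+1}`) — and the bookkeeping sentence of
row `B12.Txt@292`.

## What the paper prints (verbatim, B12 pp. 291–292)

p. 291: «This implies that the first term in (4.34), written for (4.40) instead of E^{(2)}, is represented as
  β_j(g_{j−1})½ Σ_{x,μ,ν} tr(∂δB)_{μν}(x)(∂B)_{μν}(x) + (irrelevant terms).   (4.42)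
In the second term we have the expression
  β_j(g_{j−1}) Σ_y Δ_{j,μν}(x − y)(y_κ − x_κ)(y_λ − x_λ) = −β_j(g_{j−1})((∂²/∂p′_κ∂p′_λ)Δ̃_{j,μν})(0)
  = β_j(g_{j−1})(δ_{μκ}δ_{νλ} + δ_{μλ}δ_{νκ} − 2δ_{μν}δ_{κλ}).   (4.43)
Using this equality we represent the second term as
  β_j(g_{j−1}) Σ_{x,μ,ν} tr δB_μ(x){i[B_ν(x), (δB)_{μν}(x)] + i[B_μ(x), (∂_νB_ν)(x)] + i[(∂_νB_μ)(x), B_ν(x)]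
  + i[B_ν(x), i[B_μ(x), B_ν(x)]]}.   (4.44)»
p. 292: «In the third term we have the expression
  β_j(g_{j−1}) Σ_y Δ_{k,μν}(x − y)(y_κ − x_κ) = β_j(g_{j−1})((1/i)(∂/∂p′_κ)Δ̃_{j,μν})(0) = 0,   (4.45)
hence this term vanishes. Thus the only terms in the expansion of (4.38), which we do not control yet, more exactly
for which the sum over j has not a uniform bound, are terms (4.42), (4.44). In the next section we will prove that
the polarization tensor Π has a similar structure as the operator Δ_j, especially it has an expansion of the form
(4.41), but with a coefficient. We define the β-function β_j(g_{j−1}) equal to this coefficient. The corresponding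
terms from (4.34) are equal to (4.42), (4.44) also, hence both groups of terms cancel, because (4.38) appears with
the minus sign in the effective action (1.6).»  (sic «Δ_{k,μν}» in (4.45); «(δB)_{μν}» in (4.44) read «(∂B)_{μν}»,
`B12Marginal444` remark (M1).)  p. 298: «In the third order terms in (5.43) we can always shift the derivatives onto
the other function, so we can write them in the form in which δB is differentiated once, and B twice. […] Defining
the function β_j as equal to the coefficient β in (5.43), we see that the first expression there is cancelled by the
first expression in (4.42).»

## Dictionary (everything is the tree's; this module introduces NO definition)

* `kerDeltaJ n : Fin (d+1) → Fin (d+1) → Pt (d+1) → ℂ` is the kernel FAMILY `Δ_{j,μν}(x − y)` of the typed `Δ_j` on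
  `ℤ^{d+1}` (y-sums «over the whole lattice», p. 290), a kernel family in the sense of `B12Moments443`/`B12Form543`;
  file 1 supplies `rep441` (`Δ_j = Q + Σ Δ*Δ*Δ*Δ′_j`, `j`-uniform remainder bounds) and `taylorData3_kerDeltaJ_family`.
* «the first term in (4.34) written for (4.40)» (scalar/colour-componentwise, `tr` being bilinear — exactly as in
  `B12Form543` for `Π`): `B12Form543.form (kerDeltaJ n) a b = Σ_{μν}Σ_{x,y}Δ_{j,μν}(x − y)a_μ(x)b_ν(y)`, `a = δB`,
  `b = B` finitely supported; leading term `B12Pairing543Backward.fsqB a b = ½Σ_xΣ_{μν}(curlB a)_{μν}(curlB b)_{μν}`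
  (the located backward-curl reading of record of `B12Form543`; forward reading `eq442_forward`).
* «the second term» / «the third term» of (4.34) written for (4.40): `B12Moments443.block2x (kerDeltaJ n) x c δB B C`,
  `block3x (kerDeltaJ n) x c δB B C`; (4.44)'s density is `B12Marginal444.dens444pt c δB B C`.
* The factor `β_j(g_{j−1})` of (4.40) multiplies everything linearly; it is displayed as a free scalar `βj` where
  the print displays it (`eq442_betaJ`, `block2x_betaJ`) and otherwise divided out.

## What this module proves (kernel-checked; every `n = L^j ≥ 1`, every dimension `d + 1 ≥ 1`)

* §5 **(4.42) for `Δ_j`, irrelevant terms explicit** (`eq442`, `eq442_betaJ`, `eq442_shift`, `eq442_forward`,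
  `eq442_remainder_bound`): `Σ_{(x,μ),(y,ν)} βjΔ_{j,μν}(x−y)a_μ(x)b_ν(y) = βj·½Σ_xΣ_{μν}(curlB a)_{μν}(curlB b)_{μν}
  + βj·Σ_{μν}Σ_{(κ,λ,ϱ)}Σ_{x,y}Δ′_{j,μν,κλϱ}(x−y)(∂_κ∂_λ∂_ϱa_μ)(x)b_ν(y)` (also «δB once, B twice»), remainder kernels
  bounded by `K³(MC + MQ)e^{−a|z|₁}` uniformly in `j`.
* §6 **(4.43) ⇒ (4.44) and (4.45) for `Δ_j`** (`M2x_kerDeltaJ`, `M1x_kerDeltaJ`, `M0x_kerDeltaJ`, `block2x_kerDeltaJ`,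
  `block2x_betaJ`, `block3x_kerDeltaJ`): the second term of (4.34) written for (4.40) IS `βj ×` the density (4.44);
  the third term IS `0`.
* §7 **p. 292 «both groups of terms cancel»** (`cancel292_block2`, `cancel292_block3`, `cancel292_form`,
  `cancel292_form_of_symmetries`): for ANY kernel family `Π` with «an expansion of the form (4.41) with a coefficient
  β» (`TaylorData3 β`, resp. the representation (5.37)/(5.38), resp. the four printed properties (5.6), (5.7),
  (5.9)₁, (5.10) with β = (5.42)), setting `β_j := β`: block 2 of (4.34) for `Π` minus `β_j ×` block 2 for `Δ_j` is
  `0`, block 3 likewise, and `form Π a b − β_j·form Δ_j a b` consists of the third-order remainders ONLY.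

## What is NOT claimed

That any remainder is «irrelevant» in Bałaban's technical sense (needs the field bounds (4.14)/(4.15) and the
scaling bookkeeping of §4 — out of scope, as in `B12Form543`); the resummations (4.35)–(4.39) and the passage from
`E^{(2)}` to `Π`/(4.40); that Bałaban's `Π` satisfies `TaylorData3 β` (§5 of the paper = rows B12.Eq5.*, here a
hypothesis exactly as in `B12Moments443`/`B12Form543`); the overall minus sign of (4.38) in (1.6) (the identities are
displayed as differences); the torus periodisation of the y-sums (the print extends them to `Z⁴`, p. 290); the sign
or size of `β`.  Value = kernel certificate that the typed `Δ_j` feeds the lineage's (4.34)/(5.43) machinery with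
coefficient exactly `1` and `j`-uniform remainder kernels, so that the definition «β_j(g_{j−1}) := β» produces the
printed cancellation term by term.  Nothing here is progress on a summit.
-/

noncomputable section

namespace Literature.MathematicalPhysics.QuantumFieldTheory.Balaban1983to89.B12Eq442DeltaJ

open scoped BigOperators
open Finset Complex
open Literature.MathematicalPhysics.QuantumFieldTheory.GawedzkiKupiainen1985.PeriodicGleason
  (Pt l1 ExpBound deltaIter delta K)
open Literature.MathematicalPhysics.QuantumFieldTheory.Balaban1983to89.B12Rep537 (TaylorData3 wilsonQ rem538 MQ fdelta)
open Literature.MathematicalPhysics.QuantumFieldTheory.Balaban1983to89.B12Form543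
  (form spair FinSuppV fdeltaIter ofRealK form543_of_rep form543_remainder_shift form543_forward_of_rep
    form543_of_symmetries spair_mul_kernel)
open Literature.MathematicalPhysics.QuantumFieldTheory.Balaban1983to89.B12Pairing543Backward (fsqB)
open Literature.MathematicalPhysics.QuantumFieldTheory.Balaban1983to89.B12Moments443
  (M0x M1x M2x block2x block3x moments443 moments445 moments0 block2x_of_taylorData3 block3x_of_taylorData3)
open Literature.MathematicalPhysics.QuantumFieldTheory.Balaban1983to89.B12Marginal444 (dens444pt kdA)
open Literature.MathematicalPhysics.QuantumFieldTheory.Balaban1983to89.B5Symbol166Strip (kappa166)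
open Literature.MathematicalPhysics.QuantumFieldTheory.Balaban1983to89.B12Eq443LatticeMoments (kerDeltaJ MC)
open Literature.MathematicalPhysics.QuantumFieldTheory.Balaban1983to89.B12Eq441DeltaJStructure
  (rep441 taylorData3_kerDeltaJ_family)

variable {d : ℕ}

section Form

variable (n : ℕ) [NeZero n]

/-! ## §5. (4.42) FOR `Δ_j`: «the first term in (4.34), written for (4.40) instead of E^{(2)}, is represented as
β_j(g_{j−1})½Σ_{x,μ,ν} tr(∂δB)_{μν}(x)(∂B)_{μν}(x) + (irrelevant terms)» — with the irrelevant terms explicit -/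

/-- **(4.42) for `Δ_j`, complete**: for all finitely supported lattice vector fields `a = δB`, `b = B` on `ℤ^{d+1}`,
`Σ_{(x,μ),(y,ν)} Δ_{j,μν}(x − y) a_μ(x) b_ν(y) = ½Σ_xΣ_{μν}(curlB a)_{μν}(x)(curlB b)_{μν}(x)
 + Σ_{μν}Σ_{(κ,λ,ϱ)}Σ_{x,y} Δ′_{j,μν,κλϱ}(x − y)(∂_κ∂_λ∂_ϱ a_μ)(x) b_ν(y)` — the leading term with coefficient EXACTLY
`1` (so that (4.40) carries `β_j(g_{j−1})`, `eq442_betaJ`), the remainder third order in lattice derivatives with the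
`j`-uniform kernels of `rep441` (colour trace componentwise, as in `B12Form543`). [cite: Balaban1987RG1, (4.42) p.291] -/
theorem eq442 {a b : Fin (d + 1) → Pt (d + 1) → ℂ} (ha : FinSuppV a) (hb : FinSuppV b) :
    form (kerDeltaJ n) a b = fsqB a b +
      ∑ μ, ∑ ν, ∑ μs : Fin 3 → Fin (d + 1),
        spair (rem538 (kerDeltaJ n μ ν) 1 μ ν μs) (fdeltaIter 3 μs (a μ)) (b ν) := by
  have h := form543_of_rep (Pc := kerDeltaJ n) (β := 1)
    (R := fun μ ν μs => rem538 (kerDeltaJ n μ ν) 1 μ ν μs)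
    (fun μ ν z => by rw [one_mul]; exact (rep441 n μ ν).1 z) ha hb
  rw [one_mul] at h
  exact h

/-- **(4.42) AS PRINTED, with the factor `β_j(g_{j−1})` of (4.40)**: for the kernel family `β_j·Δ_{j,μν}`,
`Σ_{(x,μ),(y,ν)} β_jΔ_{j,μν}(x − y) a_μ(x) b_ν(y) = β_j·½Σ_xΣ_{μν}(curlB a)_{μν}(curlB b)_{μν} + β_j·(third-order terms)`.
[cite: Balaban1987RG1, (4.40), (4.42) p.291] -/
theorem eq442_betaJ (βj : ℂ) {a b : Fin (d + 1) → Pt (d + 1) → ℂ} (ha : FinSuppV a) (hb : FinSuppV b) :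
    form (fun μ ν z => βj * kerDeltaJ n μ ν z) a b = βj * fsqB a b +
      βj * ∑ μ, ∑ ν, ∑ μs : Fin 3 → Fin (d + 1),
        spair (rem538 (kerDeltaJ n μ ν) 1 μ ν μs) (fdeltaIter 3 μs (a μ)) (b ν) := by
  have h : form (fun μ ν z => βj * kerDeltaJ n μ ν z) a b = βj * form (kerDeltaJ n) a b := by
    unfold form
    simp_rw [spair_mul_kernel, Finset.mul_sum]
  rw [h, eq442 n ha hb, mul_add]

/-- **(4.42) for `Δ_j` with the remainder reshuffled «δB once, B twice»** (p. 298, first sentence: «we can always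
shift the derivatives onto the other function»). [cite: Balaban1987RG1, (4.42) p.291; p.298] -/
theorem eq442_shift {a b : Fin (d + 1) → Pt (d + 1) → ℂ} (ha : FinSuppV a) (hb : FinSuppV b) :
    form (kerDeltaJ n) a b = fsqB a b +
      ∑ μ, ∑ ν, ∑ μs : Fin 3 → Fin (d + 1),
        spair (rem538 (kerDeltaJ n μ ν) 1 μ ν μs) (fdelta (μs 0) (a μ))
          (delta (μs 1) (delta (μs 2) (b ν))) := by
  have h := form543_remainder_shift (Pc := kerDeltaJ n) (β := 1)
    (R := fun μ ν μs => rem538 (kerDeltaJ n μ ν) 1 μ ν μs)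
    (fun μ ν z => by rw [one_mul]; exact (rep441 n μ ν).1 z) ha hb
  rw [one_mul] at h
  exact h

/-- **(4.42) for `Δ_j` read with the series' FORWARD curls** (`B12Pairing543.fsq`, [B5] p. 18 (1.2)): for the
reflected kernel family `z ↦ Δ_{j,μν}(−z)` the leading term is `½Σ_xΣ_{μν}(curl a)_{μν}(curl b)_{μν}` — the located
forward/backward convention of `B12Form543.form543_forward_of_rep`, harmless. [cite: Balaban1987RG1, (4.42) p.291] -/
theorem eq442_forward {a b : Fin (d + 1) → Pt (d + 1) → ℂ} (ha : FinSuppV a) (hb : FinSuppV b) :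
    form (B12Pairing543Backward.reflK (kerDeltaJ n)) a b = B12Pairing543.fsq a b +
      ∑ μ, ∑ ν, ∑ μs : Fin 3 → Fin (d + 1),
        spair (rem538 (kerDeltaJ n μ ν) 1 μ ν μs)
          (fdeltaIter 3 μs (B12Pairing543Backward.refl a μ)) (B12Pairing543Backward.refl b ν) := by
  have h := form543_forward_of_rep (Pc := kerDeltaJ n) (β := 1)
    (R := fun μ ν μs => rem538 (kerDeltaJ n μ ν) 1 μ ν μs)
    (fun μ ν z => by rw [one_mul]; exact (rep441 n μ ν).1 z) ha hb
  rw [one_mul] at h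
  exact h

/-- **the remainder kernels of (4.42) decay exponentially with constants INDEPENDENT OF `j`**:
`|Δ′_{j,μν,κλϱ}(z)| ≤ K(a,d+1)³(MC + MQ(a,d+1))e^{−a|z|₁}`, `a = κ₁₆₆(d+1)/(d+1)` — the input of the p. 298 irrelevance
argument («for which the sum over j has … a uniform bound»). [cite: Balaban1987RG1, (4.42) p.291; (5.44) p.297] -/
theorem eq442_remainder_bound (μ ν : Fin (d + 1)) (μs : Fin 3 → Fin (d + 1)) (z : Pt (d + 1)) :
    ‖rem538 (kerDeltaJ n μ ν) 1 μ ν μs z‖ ≤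
      K (kappa166 (d + 1) / (d + 1)) (d + 1) ^ 3 *
        (MC (d + 1) (kappa166 (d + 1)) + MQ (kappa166 (d + 1) / (d + 1)) (d + 1)) *
        Real.exp (-(kappa166 (d + 1) / (d + 1)) * l1 z) :=
  (rep441 n μ ν).2 μs z

/-! ## §6. (4.43) ⇒ (4.44) and (4.45) ⇒ «hence this term vanishes», FOR `Δ_j` -/

/-- **(4.43) for `Δ_j` in the moment-kernel currency of (4.34)₂**: `Σ_y Δ_{j,μν}(x − y)(y_κ − x_κ)(y_λ − x_λ) =
δ_{μκ}δ_{νλ} + δ_{μλ}δ_{νκ} − 2δ_{μν}δ_{κλ}` (`M2x`, y over the whole lattice), every `x`, every `n = L^j ≥ 1`.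
[cite: Balaban1987RG1, (4.43) p.291] -/
theorem M2x_kerDeltaJ (x : Pt (d + 1)) (μ ν κ l : Fin (d + 1)) :
    M2x (kerDeltaJ n) x μ ν κ l = kdA μ κ * kdA ν l + kdA μ l * kdA ν κ - 2 * kdA μ ν * kdA κ l := by
  rw [moments443 (taylorData3_kerDeltaJ_family n), one_mul]

/-- **(4.45) for `Δ_j` in the moment-kernel currency of (4.34)₃**: `Σ_y Δ_{j,μν}(x − y)(y_κ − x_κ) = 0`.
[cite: Balaban1987RG1, (4.45) p.292] -/
theorem M1x_kerDeltaJ (x : Pt (d + 1)) (μ ν κ : Fin (d + 1)) : M1x (kerDeltaJ n) x μ ν κ = 0 :=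
  moments445 (taylorData3_kerDeltaJ_family n) x μ ν κ

/-- the zeroth moment kernel of `Δ_j` vanishes: `Σ_y Δ_{j,μν}(x − y) = 0`. [cite: Balaban1987RG1, (4.41) p.291] -/
theorem M0x_kerDeltaJ (x : Pt (d + 1)) (μ ν : Fin (d + 1)) : M0x (kerDeltaJ n) x μ ν = 0 :=
  moments0 (taylorData3_kerDeltaJ_family n) x μ ν

variable {m : Type*} [Fintype m]

/-- **(4.43) ⇒ (4.44) FOR `Δ_j`** («Using this equality we represent the second term as (4.44)»): the second term
of (4.34) written for (4.40) — the second-moment kernels of `Δ_j` against the printed cubic/quartic local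
polynomials, at every point `x`, for all fields `δB, B` and every table `C κ ν = (∂_κB_ν)(x)` of `m × m` matrices —
EQUALS the density (4.44) `Σ_{μν} tr δB_μ{i[B_ν,(∂B)_{μν}] + i[B_μ,∂_νB_ν] + i[∂_νB_μ,B_ν] + i[B_ν,i[B_μ,B_ν]]}`
(coefficient `1`; `β_j` in `block2x_betaJ`). [cite: Balaban1987RG1, (4.43)–(4.44) p.291] -/
theorem block2x_kerDeltaJ (x : Pt (d + 1)) (c : ℂ) (δB B : Fin (d + 1) → Matrix m m ℂ)
    (C : Fin (d + 1) → Fin (d + 1) → Matrix m m ℂ) :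
    block2x (kerDeltaJ n) x c δB B C = dens444pt c δB B C := by
  rw [block2x_of_taylorData3 (taylorData3_kerDeltaJ_family n), one_mul]

/-- **(4.44) AS PRINTED, with the factor `β_j(g_{j−1})`**: the second term of (4.34) for the kernel family
`β_j·Δ_{j,μν}` is `β_j ×` the density (4.44). [cite: Balaban1987RG1, (4.40), (4.43)–(4.44) p.291] -/
theorem block2x_betaJ (βj : ℂ) (x : Pt (d + 1)) (c : ℂ) (δB B : Fin (d + 1) → Matrix m m ℂ)
    (C : Fin (d + 1) → Fin (d + 1) → Matrix m m ℂ) :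
    block2x (fun μ ν z => βj * kerDeltaJ n μ ν z) x c δB B C = βj * dens444pt c δB B C := by
  have h : ∀ μ ν κ l, M2x (fun μ ν z => βj * kerDeltaJ n μ ν z) x μ ν κ l = βj * M2x (kerDeltaJ n) x μ ν κ l := by
    intro μ ν κ l
    unfold M2x
    rw [← tsum_mul_left]
    exact tsum_congr fun y => by ring
  rw [← block2x_kerDeltaJ n x c δB B C]
  unfold block2x
  simp_rw [h, Finset.mul_sum]
  exact Finset.sum_congr rfl fun μ _ => Finset.sum_congr rfl fun ν _ => Finset.sum_congr rfl fun κ _ =>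
    Finset.sum_congr rfl fun l _ => by ring

/-- **(4.45) ⇒ «hence this term vanishes» FOR `Δ_j`**: the third term of (4.34) written for (4.40) — the first-moment
kernels of `Δ_j` against the printed bracket list `{½ tr δB_μ i[B_κ,B_ν] − … − ¼ tr δB_μ i[B_μ,i[B_κ,B_ν]]}` — is `0`
at every point `x`, every `n = L^j ≥ 1`. [cite: Balaban1987RG1, (4.45) p.292] -/
theorem block3x_kerDeltaJ (x : Pt (d + 1)) (c : ℂ) (δB B : Fin (d + 1) → Matrix m m ℂ)
    (C : Fin (d + 1) → Fin (d + 1) → Matrix m m ℂ) :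
    block3x (kerDeltaJ n) x c δB B C = 0 :=
  block3x_of_taylorData3 (taylorData3_kerDeltaJ_family n) x c δB B C

/-! ## §7. p. 292: «We define the β-function β_j(g_{j−1}) equal to this coefficient. The corresponding terms from
(4.34) are equal to (4.42), (4.44) also, hence both groups of terms cancel» -/

/-- **cancellation of the second blocks** (the (4.44)-terms): for ANY kernel family `Π` with «an expansion of the
form (4.41) with a coefficient β» (`TaylorData3 β` for every component) and `β_j := β`, block 2 of (4.34) for `Π`
minus `β_j ×` block 2 of (4.34) for `Δ_j` is `0` — at every point, for all fields. [cite: Balaban1987RG1, p.292] -/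
theorem cancel292_block2 {Pc : Fin (d + 1) → Fin (d + 1) → Pt (d + 1) → ℂ} {β : ℂ}
    (hT : ∀ μ ν, TaylorData3 β μ ν (Pc μ ν)) (x : Pt (d + 1)) (c : ℂ) (δB B : Fin (d + 1) → Matrix m m ℂ)
    (C : Fin (d + 1) → Fin (d + 1) → Matrix m m ℂ) :
    block2x Pc x c δB B C - β * block2x (kerDeltaJ n) x c δB B C = 0 := by
  rw [block2x_of_taylorData3 hT, block2x_kerDeltaJ, sub_self]

/-- **cancellation of the third blocks** (both vanish, (4.45)). [cite: Balaban1987RG1, (4.45) p.292] -/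
theorem cancel292_block3 {Pc : Fin (d + 1) → Fin (d + 1) → Pt (d + 1) → ℂ} {β : ℂ}
    (hT : ∀ μ ν, TaylorData3 β μ ν (Pc μ ν)) (x : Pt (d + 1)) (c : ℂ) (δB B : Fin (d + 1) → Matrix m m ℂ)
    (C : Fin (d + 1) → Fin (d + 1) → Matrix m m ℂ) :
    block3x Pc x c δB B C - β * block3x (kerDeltaJ n) x c δB B C = 0 := by
  rw [block3x_of_taylorData3 hT, block3x_kerDeltaJ, mul_zero, sub_self]

/-- **cancellation of the first blocks up to third-order terms** (the (4.42)-terms; p. 298 «the first expression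
there is cancelled by the first expression in (4.42)»): for ANY kernel family `Π` with the representation
(5.37)/(5.38) `Π_{μν} − βQ_{μν} = Σ Δ*Δ*Δ* Π′_{μν,κλϱ}` and `β_j := β`, the difference of the two first terms of
(4.34), `Σ Π_{μν}(x−y)a_μ(x)b_ν(y) − β_j Σ Δ_{j,μν}(x−y)a_μ(x)b_ν(y)`, consists of the third-order remainders ONLY
(the leading `½Σ tr(∂δB)(∂B)` terms cancel exactly). [cite: Balaban1987RG1, p.292; (5.43) p.297; p.298] -/
theorem cancel292_form {Pc : Fin (d + 1) → Fin (d + 1) → Pt (d + 1) → ℂ} {β : ℂ}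
    {R : Fin (d + 1) → Fin (d + 1) → (Fin 3 → Fin (d + 1)) → Pt (d + 1) → ℂ}
    (hPc : ∀ μ ν z, Pc μ ν z - β * wilsonQ μ ν z = ∑ μs : Fin 3 → Fin (d + 1), deltaIter 3 μs (R μ ν μs) z)
    {a b : Fin (d + 1) → Pt (d + 1) → ℂ} (ha : FinSuppV a) (hb : FinSuppV b) :
    form Pc a b - β * form (kerDeltaJ n) a b =
      ∑ μ, ∑ ν, ∑ μs : Fin 3 → Fin (d + 1), spair (R μ ν μs) (fdeltaIter 3 μs (a μ)) (b ν)
        - β * ∑ μ, ∑ ν, ∑ μs : Fin 3 → Fin (d + 1),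
          spair (rem538 (kerDeltaJ n μ ν) 1 μ ν μs) (fdeltaIter 3 μs (a μ)) (b ν) := by
  rw [form543_of_rep hPc ha hb, eq442 n ha hb]
  ring

/-- **the same for the cell's real B12 kernels from the four printed properties alone** — (5.10) for every component,
permutation covariance (5.6)/(5.12), single-axis reflection covariance (5.7)/(5.13), the first Ward identity
(5.9)₁/(5.15) — with `β_j := β = Σ_xΠ_{μ₀ν₀}(x)x_{μ₀}x_{ν₀}` ((5.42) = (1.22), any `μ₀ ≠ ν₀`): the first terms cancel up to
third-order remainders; the second and third blocks cancel exactly (`B12Moments443.block2x/3x_of_symmetries` with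
§6). [cite: Balaban1987RG1, p.292; (5.42)–(5.43) p.297; (5.6), (5.7), (5.9), (5.10) p.293] -/
theorem cancel292_form_of_symmetries {P : B12Beta.Kernel (d + 1)} {C₁ δ₁ : ℝ} (hδ : 0 < δ₁)
    (h510 : ∀ μ ν, B12Sec2to5.Decay510 (P μ ν) C₁ δ₁) (hperm : B12Beta.PermCovariant P)
    (hrefl : B12Transverse536.ReflCovariant P) (hward : B12Transverse536.WardFirst P)
    {μ₀ ν₀ : Fin (d + 1)} (h0 : μ₀ ≠ ν₀)
    {a b : Fin (d + 1) → Pt (d + 1) → ℂ} (ha : FinSuppV a) (hb : FinSuppV b) :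
    form (ofRealK P) a b - ((B12Beta.secondMoment P μ₀ ν₀ : ℝ) : ℂ) * form (kerDeltaJ n) a b =
      ∑ μ, ∑ ν, ∑ μs : Fin 3 → Fin (d + 1),
          spair (rem538 (B12Rep537.ofReal (P μ ν)) ((B12Beta.secondMoment P μ₀ ν₀ : ℝ) : ℂ) μ ν μs)
            (fdeltaIter 3 μs (a μ)) (b ν)
        - ((B12Beta.secondMoment P μ₀ ν₀ : ℝ) : ℂ) * ∑ μ, ∑ ν, ∑ μs : Fin 3 → Fin (d + 1),
          spair (rem538 (kerDeltaJ n μ ν) 1 μ ν μs) (fdeltaIter 3 μs (a μ)) (b ν) := by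
  rw [(form543_of_symmetries hδ h510 hperm hrefl hward h0 ha hb).1, eq442 n ha hb]
  ring

end Form

/-! ## §8 (v1.1). p. 290 FOR THE (4.40) KERNEL: the y-sums of (4.34)₂,₃ RESTRICTED to a finite set («the sums over y
are restricted to supp B ⊂ supp ζ̃_□ […] The difference between the sum over supp ζ̃_□ and the sum over Z⁴ is a sum over
a subset of (□̃³)ᶜ∩Z⁴. This gives again the exponentially small coefficients», p. 290) satisfy (4.43)/(4.45) up to
`MC·e^{−(a/2)R}·S_{a/2,p,d+1}` for every finite `Y ⊇ {y : |x − y|₁ < R}`, UNIFORMLY IN `j` (`B12WholeLattice290` fed with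
file 1's `expBound_kerDeltaJ` and §6) — so the hypotheses `hM2`/`hM1` of `B12Marginal444.block2_of_moments443` /
`block3_eq_zero_of_moments445` hold for the (4.40) kernel EXACTLY on `ℤ^{d+1}` (§6) and up to these explicit coefficients
on every such `Y` (`R` ~ dist(□, (□̃³)ᶜ) a free parameter, as in `B12WholeLattice290`); and the (5.42)-coefficient of `Δ_j`
is exactly `1`. -/

section Restricted

variable (n : ℕ) [NeZero n]
open Literature.MathematicalPhysics.QuantumFieldTheory.Balaban1983to89.B12WholeLattice290
  (S M2x_sub_sum_le M1x_sub_sum_le M0x_sub_sum_le)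
open Literature.MathematicalPhysics.QuantumFieldTheory.Balaban1983to89.B5Symbol166Strip (kappa166_pos)
open Literature.MathematicalPhysics.QuantumFieldTheory.Balaban1983to89.B12Eq441DeltaJStructure
  (expBound_kerDeltaJ taylorData3_kerDeltaJ)

/-- the decay rate of file 1 is positive. [folklore] -/
private theorem rate_pos : 0 < kappa166 (d + 1) / (d + 1) := div_pos (kappa166_pos _) (by positivity)

/-- **(4.43) for the RESTRICTED y-sums of (4.40), up to an exponentially small coefficient, uniformly in `j`**: for
every finite `Y ⊇ {y : |x − y|₁ < R}`,
`‖Σ_{y∈Y} Δ_{j,μν}(x − y)(y_κ − x_κ)(y_λ − x_λ) − (δ_{μκ}δ_{νλ} + δ_{μλ}δ_{νκ} − 2δ_{μν}δ_{κλ})‖ ≤ MC·e^{−(a/2)R}·S_{a/2,2,d+1}`,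
`a = κ₁₆₆(d+1)/(d+1)`, every `n = L^j ≥ 1`. [cite: Balaban1987RG1, p.290; (4.43) p.291] -/
theorem sum_moment2_kerDeltaJ_sub_le (μ ν κ l : Fin (d + 1)) (x : Pt (d + 1)) (R : ℝ) (Y : Finset (Pt (d + 1)))
    (hY : ∀ y, l1 (x - y) < R → y ∈ Y) :
    ‖∑ y ∈ Y, kerDeltaJ n μ ν (x - y) * (((y κ - x κ : ℤ) : ℂ) * ((y l - x l : ℤ) : ℂ))
        - (kdA μ κ * kdA ν l + kdA μ l * kdA ν κ - 2 * kdA μ ν * kdA κ l)‖ ≤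
      MC (d + 1) (kappa166 (d + 1)) * Real.exp (-(kappa166 (d + 1) / (d + 1) / 2) * R) *
        S (kappa166 (d + 1) / (d + 1) / 2) 2 (d + 1) := by
  rw [← M2x_kerDeltaJ n x μ ν κ l, norm_sub_rev]
  exact M2x_sub_sum_le rate_pos μ ν κ l (expBound_kerDeltaJ n μ ν) x R Y hY

/-- **(4.45) for the RESTRICTED y-sums of (4.40), up to an exponentially small coefficient, uniformly in `j`**:
`‖Σ_{y∈Y} Δ_{j,μν}(x − y)(y_κ − x_κ)‖ ≤ MC·e^{−(a/2)R}·S_{a/2,1,d+1}` for every finite `Y ⊇ {y : |x − y|₁ < R}` («hence this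
term vanishes» — up to the exponentially small coefficients of p. 290). [cite: Balaban1987RG1, p.290; (4.45) p.292] -/
theorem norm_sum_moment1_kerDeltaJ_le (μ ν κ : Fin (d + 1)) (x : Pt (d + 1)) (R : ℝ) (Y : Finset (Pt (d + 1)))
    (hY : ∀ y, l1 (x - y) < R → y ∈ Y) :
    ‖∑ y ∈ Y, kerDeltaJ n μ ν (x - y) * ((y κ - x κ : ℤ) : ℂ)‖ ≤
      MC (d + 1) (kappa166 (d + 1)) * Real.exp (-(kappa166 (d + 1) / (d + 1) / 2) * R) *
        S (kappa166 (d + 1) / (d + 1) / 2) 1 (d + 1) := by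
  have h := M1x_sub_sum_le rate_pos μ ν κ (expBound_kerDeltaJ n μ ν) x R Y hY
  rwa [M1x_kerDeltaJ, zero_sub, norm_neg] at h

/-- **no mass term for the RESTRICTED y-sums of (4.40)**: `‖Σ_{y∈Y} Δ_{j,μν}(x − y)‖ ≤ MC·e^{−(a/2)R}·S_{a/2,0,d+1}`
for every finite `Y ⊇ {y : |x − y|₁ < R}`. [cite: Balaban1987RG1, p.290; (4.41) p.291] -/
theorem norm_sum_moment0_kerDeltaJ_le (μ ν : Fin (d + 1)) (x : Pt (d + 1)) (R : ℝ) (Y : Finset (Pt (d + 1)))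
    (hY : ∀ y, l1 (x - y) < R → y ∈ Y) :
    ‖∑ y ∈ Y, kerDeltaJ n μ ν (x - y)‖ ≤
      MC (d + 1) (kappa166 (d + 1)) * Real.exp (-(kappa166 (d + 1) / (d + 1) / 2) * R) *
        S (kappa166 (d + 1) / (d + 1) / 2) 0 (d + 1) := by
  have h := M0x_sub_sum_le rate_pos μ ν (expBound_kerDeltaJ n μ ν) x R Y hY
  rwa [M0x_kerDeltaJ, zero_sub, norm_neg] at h

/-- the finite-`Y` second-moment kernel of `B12Marginal444` ((4.34)₂, «the sums over y restricted to supp B») for the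
(4.40) kernel IS the restricted sum (`E μ ν y = Δ_{j,μν}(x − y)`, `disp y κ = y_κ − x_κ`). [cite: Balaban1987RG1, (4.34) p.289] -/
theorem M2_kerDeltaJ_eq_sum (Y : Finset (Pt (d + 1))) (x : Pt (d + 1)) (μ ν κ l : Fin (d + 1)) :
    B12Marginal444.M2 (fun μ ν (y : Y) => kerDeltaJ n μ ν (x - (y : Pt (d + 1))))
        (fun (y : Y) κ => ((((y : Pt (d + 1)) κ - x κ : ℤ)) : ℂ)) μ ν κ l
      = ∑ y ∈ Y, kerDeltaJ n μ ν (x - y) * (((y κ - x κ : ℤ) : ℂ) * ((y l - x l : ℤ) : ℂ)) := by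
  unfold B12Marginal444.M2
  exact Finset.sum_coe_sort Y
    (fun y => kerDeltaJ n μ ν (x - y) * (((y κ - x κ : ℤ) : ℂ) * ((y l - x l : ℤ) : ℂ)))

/-- the finite-`Y` first-moment kernel of `B12Marginal444` IS the restricted sum. [cite: Balaban1987RG1, (4.34) p.289] -/
theorem M1_kerDeltaJ_eq_sum (Y : Finset (Pt (d + 1))) (x : Pt (d + 1)) (μ ν κ : Fin (d + 1)) :
    B12Marginal444.M1 (fun μ ν (y : Y) => kerDeltaJ n μ ν (x - (y : Pt (d + 1))))
        (fun (y : Y) κ => ((((y : Pt (d + 1)) κ - x κ : ℤ)) : ℂ)) μ ν κ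
      = ∑ y ∈ Y, kerDeltaJ n μ ν (x - y) * ((y κ - x κ : ℤ) : ℂ) := by
  unfold B12Marginal444.M1
  exact Finset.sum_coe_sort Y (fun y => kerDeltaJ n μ ν (x - y) * ((y κ - x κ : ℤ) : ℂ))

/-- **the hypothesis `hM2` of `B12Marginal444.block2_of_moments443` ((4.43) ⇒ (4.44)) holds for the (4.40) kernel on
every finite `Y ⊇ {y : |x − y|₁ < R}` UP TO `MC·e^{−(a/2)R}·S_{a/2,2,d+1}`** (exactly on `ℤ^{d+1}`: §6 `block2x_kerDeltaJ`).
[cite: Balaban1987RG1, p.290; (4.43)–(4.44) p.291] -/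
theorem norm_M2_kerDeltaJ_sub_le (Y : Finset (Pt (d + 1))) (x : Pt (d + 1)) (R : ℝ)
    (hY : ∀ y, l1 (x - y) < R → y ∈ Y) (μ ν κ l : Fin (d + 1)) :
    ‖B12Marginal444.M2 (fun μ ν (y : Y) => kerDeltaJ n μ ν (x - (y : Pt (d + 1))))
          (fun (y : Y) κ => ((((y : Pt (d + 1)) κ - x κ : ℤ)) : ℂ)) μ ν κ l
        - (kdA μ κ * kdA ν l + kdA μ l * kdA ν κ - 2 * kdA μ ν * kdA κ l)‖ ≤
      MC (d + 1) (kappa166 (d + 1)) * Real.exp (-(kappa166 (d + 1) / (d + 1) / 2) * R) *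
        S (kappa166 (d + 1) / (d + 1) / 2) 2 (d + 1) := by
  rw [M2_kerDeltaJ_eq_sum]
  exact sum_moment2_kerDeltaJ_sub_le n μ ν κ l x R Y hY

/-- **the hypothesis `hM1` of `B12Marginal444.block3_eq_zero_of_moments445` ((4.45) ⇒ «this term vanishes») holds for
the (4.40) kernel on every finite `Y ⊇ {y : |x − y|₁ < R}` UP TO `MC·e^{−(a/2)R}·S_{a/2,1,d+1}`** (exactly on `ℤ^{d+1}`:
§6 `block3x_kerDeltaJ`). [cite: Balaban1987RG1, p.290; (4.45) p.292] -/
theorem norm_M1_kerDeltaJ_le (Y : Finset (Pt (d + 1))) (x : Pt (d + 1)) (R : ℝ)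
    (hY : ∀ y, l1 (x - y) < R → y ∈ Y) (μ ν κ : Fin (d + 1)) :
    ‖B12Marginal444.M1 (fun μ ν (y : Y) => kerDeltaJ n μ ν (x - (y : Pt (d + 1))))
        (fun (y : Y) κ => ((((y : Pt (d + 1)) κ - x κ : ℤ)) : ℂ)) μ ν κ‖ ≤
      MC (d + 1) (kappa166 (d + 1)) * Real.exp (-(kappa166 (d + 1) / (d + 1) / 2) * R) *
        S (kappa166 (d + 1) / (d + 1) / 2) 1 (d + 1) := by
  rw [M1_kerDeltaJ_eq_sum]
  exact norm_sum_moment1_kerDeltaJ_le n μ ν κ x R Y hY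

/-- **the coefficient of `Δ_j` in the sense of (5.42) is exactly `1`**: `Σ_{x∈ℤ^{d+1}} Δ_{j,μν}(x)x_μx_ν = 1`, `μ ≠ ν`,
every `n = L^j ≥ 1` ((5.42) written for `Δ_j`, `B12Rep537.beta_eq_542`) — so «β_j(g_{j−1}) equal to this coefficient»
(p. 292) matches the leading terms of `Π` and `β_jΔ_j` with ratio exactly `β`. [cite: Balaban1987RG1, p.292; (5.42) p.297] -/
theorem secondMoment_kerDeltaJ {μ ν : Fin (d + 1)} (h : μ ≠ ν) :
    ∑' x : Pt (d + 1), kerDeltaJ n μ ν x * (((x μ : ℤ) : ℂ) * ((x ν : ℤ) : ℂ)) = 1 :=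
  (B12Rep537.beta_eq_542 (taylorData3_kerDeltaJ n μ ν) h).symm

end Restricted

end Literature.MathematicalPhysics.QuantumFieldTheory.Balaban1983to89.B12Eq442DeltaJ

end
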